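import Summits.CriticalPhenomena.PercolationContinuityZ3.Theorems.Transplant.FKConnectivityAllQForestAdjacentPathGadgetAssembly
import HarnessLib

/-!
# The square-free adjacent forest node when `v` hangs on a path gadget (star side)

builds on p205010 (kernel theorem, internal audit signed; external expert review pending).  No definitions, no named facts, no sorries;
standard axioms.

Special case of `adjForestNoSq_fibre_of_pathGadget_signFacts` (`…PathGadgetAssembly`; memo bschramm/FROM-fk-1-g20-SEPARATOR-EXCHANGE.md
§3(iii)): if every side-1 pair contains `v` (side 1 is a star centred at `v`, e.g. `deg v = 3` with `N(v) = {o, p, q}`, `op, oq` present,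
`pq` absent — the wheel family `W(k;t)` of memo g19 §2b is of this kind), then NO side-1 colouring has type (`pq`, `d`) (joining `p, q`
through `v` forces `o ~ p`), so the node across the separator follows from the side-2 sign fact `n₂(pq,d;f) ≤ n₂(d,pq;f)` ALONE.
* **`adjForestNoSq_fibre_of_pathGadget_star`**.
[cite: SempleWelsh2008, Conj. 1.1 (p. 2)] [cite: Linusson2011, Prop. 2.6] [cite: Grimmett2006, §3.8 (pp. 61–62)]
-/

noncomputable section

namespace Summit.CriticalPhenomena.PercolationContinuityZ3.Theorems

namespace FK

open Set SimpleGraph Literature.Probability.LatticeModels Literature.Probability.Percolation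
open scoped Classical

variable {V : Type*} [Fintype V]

section PathGadgetStar

open scoped symmDiff

variable {E₁ E₂ : Set (Sym2 V)} {V₁ V₂ : Set V} {M u₀ : BondConfig V} {o p q v y : V}

omit [Fintype V] in
/-- In a star centred at `v`, a join of `p ≠ q` uses the pair `vp`. [folklore] -/
theorem mem_of_reachable_star {X : BondConfig V} (hstar : ∀ g ∈ X, v ∈ g) {a b : V} (hab : a ≠ b) (hav : a ≠ v)
    (h : (openGraph X).Reachable a b) : s(a, v) ∈ X := by
  obtain ⟨w⟩ := h
  cases w with
  | nil => exact absurd rfl hab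
  | cons hadj _ =>
    obtain ⟨hmem, -⟩ := (openGraph_adj X _ _).1 hadj
    rcases Sym2.mem_iff.1 (hstar _ hmem) with h | h
    · exact absurd h.symm hav
    · rw [h]; exact hmem

/-- **The node across a path-gadget separator whose first side is a star at `v`, from the side-2 sign fact alone.**
[cite: SempleWelsh2008, Conj. 1.1 (p. 2)] [cite: Linusson2011, Prop. 2.6] [cite: Grimmett2006, §3.8 (pp. 61–62)] -/
theorem adjForestNoSq_fibre_of_pathGadget_star (hop : o ≠ p) (hoq : o ≠ q) (hpq : p ≠ q)
    (h₁ : ∀ e ∈ E₁, ∀ z ∈ e, z ∈ V₁) (h₂ : ∀ e ∈ E₂, ∀ z ∈ e, z ∈ V₂) (hS : V₁ ∩ V₂ ⊆ ({o, p, q} : Set V))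
    (hd : Disjoint E₁ E₂) (hn₁ : ∀ x ∈ ({o, p, q} : Set V), ∀ x' ∈ ({o, p, q} : Set V), s(x, x') ∉ E₁)
    (hn₂ : ∀ x ∈ ({o, p, q} : Set V), ∀ x' ∈ ({o, p, q} : Set V), s(x, x') ∉ E₂)
    (heE : s(o, v) ∈ E₁) (hfE : s(o, y) ∈ E₂)
    (hM' : insert s(o, y) (insert s(o, v) M) ∪ u₀ ⊆ ({s(o, p), s(o, q)} : Set (Sym2 V)) ∪ (E₁ ∪ E₂))
    (hgp : s(o, p) ∈ insert s(o, y) (insert s(o, v) M)) (hgq : s(o, q) ∈ insert s(o, y) (insert s(o, v) M))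
    (Rset Res : Set (BondConfig V))
    (hRset : ∀ ω, ω ∈ Rset ↔
      ((¬ ∀ x ∈ ({o, p, q} : Set V), ∀ x' ∈ ({o, p, q} : Set V),
        (openGraph (ω ∩ E₁)).Reachable x x' ↔ (openGraph ((ω ∆ insert s(o, y) (insert s(o, v) M)) ∩ E₁)).Reachable x x') ∧
      (¬ ∀ x ∈ ({o, p, q} : Set V), ∀ x' ∈ ({o, p, q} : Set V),
        (openGraph (ω ∩ E₂)).Reachable x x' ↔ (openGraph ((ω ∆ insert s(o, y) (insert s(o, v) M)) ∩ E₂)).Reachable x x')))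
    (hRes : ∀ ω, ω ∈ Res ↔
      (((openGraph (ω ∩ E₂)).Reachable p q ∧ (openGraph ((ω ∆ insert s(o, y) (insert s(o, v) M)) ∩ E₁)).Reachable p q) ∨
      ((openGraph (ω ∩ E₁)).Reachable p q ∧ (openGraph ((ω ∆ insert s(o, y) (insert s(o, v) M)) ∩ E₂)).Reachable p q)))
    (hstar : ∀ g ∈ E₁, v ∈ g)
    (T₂ T₂' : Set (BondConfig V))
    (hT₂ : ∀ Y, Y ∈ T₂ ↔ Y ⊆ E₂ ∧ Y \ (insert s(o, y) (insert s(o, v) M) ∩ E₂) = u₀ ∩ E₂ ∧ IsForestCfg Y ∧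
      IsForestCfg (Y ∆ (insert s(o, y) (insert s(o, v) M) ∩ E₂)) ∧ s(o, y) ∈ Y ∧
      ((openGraph Y).Reachable p q ∧ ¬ (openGraph Y).Reachable o p ∧ ¬ (openGraph Y).Reachable o q) ∧
      (∀ x ∈ ({o, p, q} : Set V), ∀ x' ∈ ({o, p, q} : Set V),
        (openGraph (Y ∆ (insert s(o, y) (insert s(o, v) M) ∩ E₂))).Reachable x x' → x = x'))
    (hT₂' : ∀ Y, Y ∈ T₂' ↔ Y ⊆ E₂ ∧ Y \ (insert s(o, y) (insert s(o, v) M) ∩ E₂) = u₀ ∩ E₂ ∧ IsForestCfg Y ∧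
      IsForestCfg (Y ∆ (insert s(o, y) (insert s(o, v) M) ∩ E₂)) ∧ s(o, y) ∈ Y ∧
      (∀ x ∈ ({o, p, q} : Set V), ∀ x' ∈ ({o, p, q} : Set V), (openGraph Y).Reachable x x' → x = x') ∧
      ((openGraph (Y ∆ (insert s(o, y) (insert s(o, v) M) ∩ E₂))).Reachable p q ∧
        ¬ (openGraph (Y ∆ (insert s(o, y) (insert s(o, v) M) ∩ E₂))).Reachable o p ∧
        ¬ (openGraph (Y ∆ (insert s(o, y) (insert s(o, v) M) ∩ E₂))).Reachable o q))
    (hle₂ : T₂.ncard ≤ T₂'.ncard) :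
    fibreCount (insert s(o, y) (insert s(o, v) M)) u₀ (forestEv V ∩ {ω | s(o, v) ∈ ω ∧ s(o, y) ∈ ω}) (forestEv V) ≤
      fibreCount (insert s(o, y) (insert s(o, v) M)) u₀ (forestEv V ∩ {ω | s(o, v) ∈ ω}) (forestEv V ∩ {ω | s(o, y) ∈ ω}) := by
  -- the side-1 colourings of type (`pq`, `d`): none
  set T₁ : Set (BondConfig V) := {X | X ⊆ E₁ ∧ X \ (insert s(o, y) (insert s(o, v) M) ∩ E₁) = u₀ ∩ E₁ ∧ IsForestCfg X ∧
      IsForestCfg (X ∆ (insert s(o, y) (insert s(o, v) M) ∩ E₁)) ∧ s(o, v) ∈ X ∧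
      ((openGraph X).Reachable p q ∧ ¬ (openGraph X).Reachable o p ∧ ¬ (openGraph X).Reachable o q) ∧
      (∀ x ∈ ({o, p, q} : Set V), ∀ x' ∈ ({o, p, q} : Set V),
        (openGraph (X ∆ (insert s(o, y) (insert s(o, v) M) ∩ E₁))).Reachable x x' → x = x')} with hT₁def
  set T₁' : Set (BondConfig V) := {X | X ⊆ E₁ ∧ X \ (insert s(o, y) (insert s(o, v) M) ∩ E₁) = u₀ ∩ E₁ ∧ IsForestCfg X ∧
      IsForestCfg (X ∆ (insert s(o, y) (insert s(o, v) M) ∩ E₁)) ∧ s(o, v) ∈ X ∧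
      (∀ x ∈ ({o, p, q} : Set V), ∀ x' ∈ ({o, p, q} : Set V), (openGraph X).Reachable x x' → x = x') ∧
      ((openGraph (X ∆ (insert s(o, y) (insert s(o, v) M) ∩ E₁))).Reachable p q ∧
        ¬ (openGraph (X ∆ (insert s(o, y) (insert s(o, v) M) ∩ E₁))).Reachable o p ∧
        ¬ (openGraph (X ∆ (insert s(o, y) (insert s(o, v) M) ∩ E₁))).Reachable o q)} with hT₁'def
  have hempty : T₁ = ∅ := by
    refine Set.eq_empty_iff_forall_notMem.2 fun X hX => ?_
    obtain ⟨hXE, -, -, -, heX, ⟨hpq', hnop, -⟩, -⟩ := hX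
    have hstarX : ∀ g ∈ X, v ∈ g := fun g hg => hstar g (hXE hg)
    have hpv' : p ≠ v := fun h => hn₁ o (mem_insert _ _) p (mem_insert_of_mem _ (mem_insert _ _)) (by rw [h]; exact heE)
    have hov : o ≠ v := fun h => hn₁ o (mem_insert _ _) o (mem_insert _ _) (by
      have hvv : s(o, v) ∈ E₁ := heE
      rw [← h] at hvv; exact hvv)
    have hpv : s(p, v) ∈ X := mem_of_reachable_star hstarX hpq hpv' hpq'
    exact hnop ((reachable_of_mem hov heX).trans (reachable_of_mem hpv'.symm (by rw [Sym2.eq_swap]; exact hpv)))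
  have hle₁ : T₁.ncard ≤ T₁'.ncard := by rw [hempty, Set.ncard_empty]; exact Nat.zero_le _
  exact adjForestNoSq_fibre_of_pathGadget_signFacts hop hoq hpq h₁ h₂ hS hd hn₁ hn₂ heE hfE hM' hgp hgq Rset Res hRset hRes T₁ T₁'
    (fun X => Iff.rfl) (fun X => Iff.rfl) T₂ T₂' hT₂ hT₂' hle₁ hle₂

end PathGadgetStar

end FK

end Summit.CriticalPhenomena.PercolationContinuityZ3.Theorems

end
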